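import Literature.Probability.Percolation.ConstrainedClusters
import Literature.Probability.Percolation.FiniteEnergy
import Literature.Probability.Percolation.MeanFieldBetaFromGamma
import Literature.Probability.Percolation.SharpnessDCTProofs
import Literature.Probability.Percolation.PercolationProofs
import Literature.Probability.Percolation.TwoGhostInequalityProofs
import HarnessLib

/-!
# Mirror squaring: sealing the lower half-space cluster (crux `QuantitativeBGN`, stmt-CriticalPhenomena-0913)

Line `mirror-akn-two-arm-import` (volume form), lead prover-line-stmt-CriticalPhenomena-0913-c1-0.
Lands with `--supports stmt-CriticalPhenomena-0913`.

Objects (expanded, no new definitions): the lower half-space step graph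
`H⁻ = withinGraph (zdGraph 3) {x | x 0 ≤ 0}` rooted at `0`, the upper one
`H⁺ = withinGraph (zdGraph 3) {x | 1 ≤ x 0}` rooted at `e₀ = Pi.single 0 1`, the volume events
`volDn n = {n ≤ |C_{H⁻}(0)|}`, `volUp n = {n ≤ |C_{H⁺}(e₀)|}` (`openClusterIn`, `Set.encard`), the
FOOT of the lower cluster `F(ω) = C_{H⁻}(0) ∩ {x | x 0 = 0}` and the thin-foot event
`footLe k = {|F| ≤ k}`.

Results (every `p ∈ [0,1]`, every `n k : ℕ`):

* `MirrorSealing.not_reachable_of_sealed` — SEALING: for a configuration on lattice edges, if every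
  vertical edge `{v, v + e₀}` above the foot `F(ω)` is closed then the bulk cluster of `0` IS the
  lower half-space cluster, in particular `0 ↮ e₀`.
* `MirrorSealing.real_volUp_inter_volDn_footLe` — independence of the two halves:
  `P(volUp n ∩ (volDn n ∩ footLe k)) = P(volUp n) · P(volDn n ∩ footLe k)`.
* `mirror_sealing_bound` — **`(1 − p)^k · P_p(volUp n) · P_p(volDn n ∩ footLe k)
  ≤ P_p(volUp n ∩ volDn n ∩ {0 ↮ e₀})`**: closing the `≤ k` vertical edges above a thin foot
  (finite energy, `bondPercolation_real_finiteEnergy`, conditionally on the two half-configurations)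
  seals the lower cluster and makes the two bulk clusters distinct.

With STUB 2 of the line (`stub_mirrorTwoGhost`: the right-hand side is at most Hutchcroft's
`P_p(𝒮_{e,n}) ≤ 396 √((1−p)/(pn))`) and STUB 1 (`P(volUp n) = P(volDn n) = w_p(n)`), this gives the
unconditional thin-foot bound `P_p(volDn n ∩ footLe k)² ≤ 396 (1−p)^{-k} √((1−p)/(pn))`: at `p_c(ℤ³)`
large half-space clusters with bounded feet are polynomially rare (`≲ n^{-1/4}`), so the open stub
`stub_mirrorNonCoalescence` (non-coalescence with exponent `b < 1/2`) is a statement about clusters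
with LARGE feet — the direct-sealing lower bound `E[(1−p)^{|F|}; volDn n]·w(n) ≤ P(volUp ∩ volDn ∩ distinct)`
recorded here is its `k`-truncated form.
-/

noncomputable section

namespace Summit.CriticalPhenomena.PercolationContinuityZ3.Theorems

open MeasureTheory Literature.Probability.Percolation Literature.Probability.LatticeModels

namespace MirrorSealing

/-! ### Lattice geometry at the interface `x₀ ∈ {0, 1}` -/

/-- A lattice edge from `{x₀ ≤ 0}` to `{x₀ ≥ 1}` is a vertical edge `{a, a + e₀}` with `a₀ = 0`. -/
theorem eq_add_single_of_adj {a b : Site 3} (h : (zdGraph 3).Adj a b) (ha : a 0 ≤ 0) (hb : ¬ b 0 ≤ 0) :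
    a 0 = 0 ∧ b = a + Pi.single 0 1 := by
  rw [zdGraph_adj_iff] at h
  obtain ⟨i, h | h⟩ := h
  · subst h
    fin_cases i
    · refine ⟨?_, rfl⟩
      simp only [Fin.zero_eta, Pi.add_apply, Pi.single_eq_same, not_le] at hb
      omega
    · exfalso; apply hb
      simp only [Fin.mk_one, Pi.add_apply, ne_eq, one_ne_zero, not_false_eq_true,
        Pi.single_eq_of_ne', add_zero]
      simpa using ha
    · exfalso; apply hb
      simp only [Fin.reduceFinMk, Pi.add_apply, ne_eq, Fin.reduceEq, not_false_eq_true,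
        Pi.single_eq_of_ne', add_zero]
      simpa using ha
  · subst h
    exfalso; apply hb
    simp only [Pi.add_apply] at ha
    have : (0 : ℤ) ≤ (Pi.single i (1 : ℤ) : Site 3) 0 := by
      rcases eq_or_ne (0 : Fin 3) i with h0 | h0
      · subst h0; simp
      · simp [Pi.single_eq_of_ne h0]
    omega

/-- The vertical edge `{v, v + e₀}` above a floor vertex (`v₀ = 0`) is not an edge of `H⁺`. -/
theorem edgeUp_notMem_up {v : Site 3} (hv : v 0 = 0) :
    s(v, v + Pi.single 0 1) ∉ (withinGraph (zdGraph 3) {x : Site 3 | 1 ≤ x 0}).edgeSet := by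
  rw [mem_edgeSet_withinGraph]
  rintro ⟨-, h1, -⟩
  simp only [Set.mem_setOf_eq] at h1
  omega

/-- The vertical edge `{v, v + e₀}` above a floor vertex (`v₀ = 0`) is not an edge of `H⁻`. -/
theorem edgeUp_notMem_dn {v : Site 3} (hv : v 0 = 0) :
    s(v, v + Pi.single 0 1) ∉ (withinGraph (zdGraph 3) {x : Site 3 | x 0 ≤ 0}).edgeSet := by
  rw [mem_edgeSet_withinGraph]
  rintro ⟨-, -, h2⟩
  simp only [Set.mem_setOf_eq, Pi.add_apply, Pi.single_eq_same] at h2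
  omega

/-- The two half-space step graphs have disjoint edge sets. -/
theorem disjoint_edgeSet_up_dn :
    Disjoint (withinGraph (zdGraph 3) {x : Site 3 | 1 ≤ x 0}).edgeSet
      (withinGraph (zdGraph 3) {x : Site 3 | x 0 ≤ 0}).edgeSet := by
  rw [Set.disjoint_left]
  intro e
  induction e using Sym2.ind with
  | _ u v =>
    intro hu hd
    rw [mem_edgeSet_withinGraph] at hu hd
    have h1 : (1 : ℤ) ≤ u 0 := hu.2.1
    have h2 : u 0 ≤ 0 := hd.2.1
    omega

/-! ### Sealing -/

/-- **Sealing the lower half-space cluster.** For a configuration on lattice edges, if every vertical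
edge `{v, v + e₀}` above the foot of the `H⁻`-cluster of `0` is closed, then the bulk cluster of `0`
is contained in (hence equal to) that `H⁻`-cluster. -/
theorem openCluster_subset_of_sealed {ω : BondConfig (Site 3)} (hω : ω ⊆ (zdGraph 3).edgeSet)
    (hseal : ∀ v ∈ openClusterIn (withinGraph (zdGraph 3) {x : Site 3 | x 0 ≤ 0}) ω 0, v 0 = 0 →
      s(v, v + Pi.single 0 1) ∉ ω) :
    openCluster ω 0 ⊆ openClusterIn (withinGraph (zdGraph 3) {x : Site 3 | x 0 ≤ 0}) ω 0 := by
  refine TwoGhost.openCluster_subset_of_closed (self_mem_openClusterIn _ _ _) ?_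
  intro x hx y hxy
  rw [openGraph_adj] at hxy
  have hadj : (zdGraph 3).Adj x y := by simpa [SimpleGraph.mem_edgeSet] using hω hxy.1
  have hx0 : x 0 ≤ 0 :=
    openClusterIn_withinGraph_subset (x := (0 : Site 3)) (show (0 : Site 3) 0 ≤ 0 from le_rfl) ω hx
  by_cases hy0 : y 0 ≤ 0
  · exact mem_openClusterIn_of_adj hx ((withinGraph_adj).2 ⟨hadj, hx0, hy0⟩) hxy.1
  · obtain ⟨hx00, rfl⟩ := eq_add_single_of_adj hadj hx0 hy0
    exact absurd hxy.1 (hseal x hx hx00)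

/-- **Sealing ⇒ distinct bulk clusters**: under the hypotheses of `openCluster_subset_of_sealed`,
`0 ↮ e₀`. -/
theorem not_reachable_of_sealed {ω : BondConfig (Site 3)} (hω : ω ⊆ (zdGraph 3).edgeSet)
    (hseal : ∀ v ∈ openClusterIn (withinGraph (zdGraph 3) {x : Site 3 | x 0 ≤ 0}) ω 0, v 0 = 0 →
      s(v, v + Pi.single 0 1) ∉ ω) :
    ¬ (openGraph ω).Reachable (0 : Site 3) (Pi.single 0 1) := by
  intro h
  have hmem : (Pi.single 0 1 : Site 3) ∈ openClusterIn (withinGraph (zdGraph 3) {x : Site 3 | x 0 ≤ 0}) ω 0 :=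
    openCluster_subset_of_sealed hω hseal h
  have := openClusterIn_withinGraph_subset (x := (0 : Site 3)) (show (0 : Site 3) 0 ≤ 0 from le_rfl) ω hmem
  simp at this

/-! ### Events of the lower half-configuration: determined by `E(H⁻)`, measurable -/

/-- An event read on the `H⁻`-cluster of `0` is the preimage, under restriction to `E(H⁻)`, of the same
event read on the bulk cluster (definitional: `openClusterIn K ω x = openCluster (ω ∩ E(K)) x`). -/
theorem setOf_openClusterIn_eq_preimage (Q : Set (Site 3) → Prop) :
    {ω : BondConfig (Site 3) | Q (openClusterIn (withinGraph (zdGraph 3) {x : Site 3 | x 0 ≤ 0}) ω 0)} =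
      (fun ω : BondConfig (Site 3) => ω ∩ (withinGraph (zdGraph 3) {x : Site 3 | x 0 ≤ 0}).edgeSet) ⁻¹'
        {ω | Q (openCluster ω 0)} := rfl

/-- Every event read on the `H⁻`-cluster of `0` is determined by the edges of `H⁻`. -/
theorem determinedBy_setOf_openClusterIn (Q : Set (Site 3) → Prop) :
    DeterminedBy {ω : BondConfig (Site 3) | Q (openClusterIn (withinGraph (zdGraph 3) {x : Site 3 | x 0 ≤ 0}) ω 0)}
      (withinGraph (zdGraph 3) {x : Site 3 | x 0 ≤ 0}).edgeSet := by
  rw [setOf_openClusterIn_eq_preimage]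
  exact determinedBy_preimage_inter _ _

/-- `{v ∈ C_{H⁻}(0)}` is measurable. -/
theorem measurableSet_mem_openClusterIn (v : Site 3) :
    MeasurableSet {ω : BondConfig (Site 3) | v ∈ openClusterIn (withinGraph (zdGraph 3) {x : Site 3 | x 0 ≤ 0}) ω 0} := by
  rw [setOf_openClusterIn_eq_preimage (fun C => v ∈ C)]
  exact (measurableSet_openConn_holds (0 : Site 3) v).preimage (measurable_inter_const _)

/-- `volDn n = {n ≤ |C_{H⁻}(0)|}` is measurable. -/
theorem measurableSet_volDn (n : ℕ) :
    MeasurableSet {ω : BondConfig (Site 3) | (n : ℕ∞) ≤ (openClusterIn (withinGraph (zdGraph 3) {x : Site 3 | x 0 ≤ 0}) ω 0).encard} := by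
  rw [setOf_openClusterIn_eq_preimage (fun C => (n : ℕ∞) ≤ C.encard)]
  exact (measurableSet_clusterSizeGe (0 : Site 3) n).preimage (measurable_inter_const _)

/-- `volUp n = {n ≤ |C_{H⁺}(e₀)|}` is measurable. -/
theorem measurableSet_volUp (n : ℕ) :
    MeasurableSet {ω : BondConfig (Site 3) | (n : ℕ∞) ≤ (openClusterIn (withinGraph (zdGraph 3) {x : Site 3 | 1 ≤ x 0}) ω (Pi.single 0 1)).encard} :=
  (measurableSet_clusterSizeGe (Pi.single 0 1 : Site 3) n).preimage (measurable_inter_const _)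

/-- `volUp n` is determined by the edges of `H⁺`. -/
theorem determinedBy_volUp (n : ℕ) :
    DeterminedBy {ω : BondConfig (Site 3) | (n : ℕ∞) ≤ (openClusterIn (withinGraph (zdGraph 3) {x : Site 3 | 1 ≤ x 0}) ω (Pi.single 0 1)).encard}
      (withinGraph (zdGraph 3) {x : Site 3 | 1 ≤ x 0}).edgeSet :=
  determinedBy_preimage_inter _ (clusterSizeGe (Pi.single 0 1 : Site 3) n)

/-- The event "the foot of `C_{H⁻}(0)` is exactly `B`" is measurable (a countable intersection over the
sites `v` of the events `{v ∈ foot ↔ v ∈ B}`). -/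
theorem measurableSet_foot_eq (B : Set (Site 3)) :
    MeasurableSet {ω : BondConfig (Site 3) |
      openClusterIn (withinGraph (zdGraph 3) {x : Site 3 | x 0 ≤ 0}) ω 0 ∩ {x : Site 3 | x 0 = 0} = B} := by
  have h : {ω : BondConfig (Site 3) |
      openClusterIn (withinGraph (zdGraph 3) {x : Site 3 | x 0 ≤ 0}) ω 0 ∩ {x : Site 3 | x 0 = 0} = B} =
      ⋂ v : Site 3, {ω | (v ∈ openClusterIn (withinGraph (zdGraph 3) {x : Site 3 | x 0 ≤ 0}) ω 0 ∧ v 0 = 0) ↔ v ∈ B} := by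
    ext ω
    simp only [Set.mem_setOf_eq, Set.mem_iInter, Set.ext_iff, Set.mem_inter_iff]
  rw [h]
  refine MeasurableSet.iInter fun v => ?_
  by_cases hvB : v ∈ B
  · by_cases hv0 : v 0 = 0
    · have : {ω : BondConfig (Site 3) | (v ∈ openClusterIn (withinGraph (zdGraph 3) {x : Site 3 | x 0 ≤ 0}) ω 0 ∧ v 0 = 0) ↔ v ∈ B} =
          {ω | v ∈ openClusterIn (withinGraph (zdGraph 3) {x : Site 3 | x 0 ≤ 0}) ω 0} := by
        ext ω; simp [hvB, hv0]
      rw [this]; exact measurableSet_mem_openClusterIn v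
    · have : {ω : BondConfig (Site 3) | (v ∈ openClusterIn (withinGraph (zdGraph 3) {x : Site 3 | x 0 ≤ 0}) ω 0 ∧ v 0 = 0) ↔ v ∈ B} = ∅ := by
        ext ω; simp [hvB, hv0]
      rw [this]; exact MeasurableSet.empty
  · by_cases hv0 : v 0 = 0
    · have : {ω : BondConfig (Site 3) | (v ∈ openClusterIn (withinGraph (zdGraph 3) {x : Site 3 | x 0 ≤ 0}) ω 0 ∧ v 0 = 0) ↔ v ∈ B} =
          {ω | v ∈ openClusterIn (withinGraph (zdGraph 3) {x : Site 3 | x 0 ≤ 0}) ω 0}ᶜ := by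
        ext ω; simp [hvB, hv0]
      rw [this]; exact (measurableSet_mem_openClusterIn v).compl
    · have : {ω : BondConfig (Site 3) | (v ∈ openClusterIn (withinGraph (zdGraph 3) {x : Site 3 | x 0 ≤ 0}) ω 0 ∧ v 0 = 0) ↔ v ∈ B} = Set.univ := by
        ext ω; simp [hvB, hv0]
      rw [this]; exact MeasurableSet.univ

/-- `footLe k = {|foot| ≤ k}` is measurable: it is the countable union over finite sets `B` with `|B| ≤ k`
of the events `{foot = B}`. -/
theorem measurableSet_footLe (k : ℕ) :
    MeasurableSet {ω : BondConfig (Site 3) |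
      (openClusterIn (withinGraph (zdGraph 3) {x : Site 3 | x 0 ≤ 0}) ω 0 ∩ {x : Site 3 | x 0 = 0}).encard ≤ k} := by
  have h : {ω : BondConfig (Site 3) |
      (openClusterIn (withinGraph (zdGraph 3) {x : Site 3 | x 0 ≤ 0}) ω 0 ∩ {x : Site 3 | x 0 = 0}).encard ≤ k} =
      ⋃ B : {B : Finset (Site 3) // B.card ≤ k}, {ω |
        openClusterIn (withinGraph (zdGraph 3) {x : Site 3 | x 0 ≤ 0}) ω 0 ∩ {x : Site 3 | x 0 = 0} = ↑(B : Finset (Site 3))} := by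
    ext ω
    simp only [Set.mem_setOf_eq, Set.mem_iUnion, Subtype.exists, exists_prop]
    constructor
    · intro hk
      have hfin : (openClusterIn (withinGraph (zdGraph 3) {x : Site 3 | x 0 ≤ 0}) ω 0 ∩ {x : Site 3 | x 0 = 0}).Finite :=
        Set.finite_of_encard_le_coe hk
      refine ⟨hfin.toFinset, ?_, by simp⟩
      have := hfin.encard_eq_coe_toFinset_card
      rw [this] at hk
      exact_mod_cast hk
    · rintro ⟨B, hB, hBeq⟩
      rw [hBeq, Set.encard_coe_eq_coe_finsetCard]
      exact_mod_cast hB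
  rw [h]
  exact MeasurableSet.iUnion fun B => measurableSet_foot_eq _

/-! ### Independence of the two halves -/

/-- **`P(volUp n ∩ (volDn n ∩ footLe k)) = P(volUp n) · P(volDn n ∩ footLe k)`**: the two events are
determined by the disjoint edge sets `E(H⁺)` and `E(H⁻)`. -/
theorem real_volUp_inter_volDn_footLe (p : unitInterval) (n k : ℕ) :
    (bondPercolation (zdGraph 3) p).real
        ({ω | (n : ℕ∞) ≤ (openClusterIn (withinGraph (zdGraph 3) {x : Site 3 | 1 ≤ x 0}) ω (Pi.single 0 1)).encard} ∩
          ({ω | (n : ℕ∞) ≤ (openClusterIn (withinGraph (zdGraph 3) {x : Site 3 | x 0 ≤ 0}) ω 0).encard} ∩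
            {ω | (openClusterIn (withinGraph (zdGraph 3) {x : Site 3 | x 0 ≤ 0}) ω 0 ∩ {x : Site 3 | x 0 = 0}).encard ≤ k})) =
      (bondPercolation (zdGraph 3) p).real
          {ω | (n : ℕ∞) ≤ (openClusterIn (withinGraph (zdGraph 3) {x : Site 3 | 1 ≤ x 0}) ω (Pi.single 0 1)).encard} *
        (bondPercolation (zdGraph 3) p).real
          ({ω | (n : ℕ∞) ≤ (openClusterIn (withinGraph (zdGraph 3) {x : Site 3 | x 0 ≤ 0}) ω 0).encard} ∩
            {ω | (openClusterIn (withinGraph (zdGraph 3) {x : Site 3 | x 0 ≤ 0}) ω 0 ∩ {x : Site 3 | x 0 = 0}).encard ≤ k}) := by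
  refine bondPercolation_real_inter_of_disjoint (zdGraph 3) p disjoint_edgeSet_up_dn (determinedBy_volUp n)
    ?_ (measurableSet_volUp n) ((measurableSet_volDn n).inter (measurableSet_footLe k))
  exact (determinedBy_setOf_openClusterIn (fun C => (n : ℕ∞) ≤ C.encard)).inter
    (determinedBy_setOf_openClusterIn (fun C => (C ∩ {x : Site 3 | x 0 = 0}).encard ≤ k))

end MirrorSealing

open MirrorSealing in
/-- **Mirror sealing bound.** For every `p ∈ [0,1]` and all `n k : ℕ`:
`(1 − p)^k · P_p(volUp n) · P_p(volDn n ∩ footLe k) ≤ P_p(volUp n ∩ volDn n ∩ {0 ↮ e₀})`, where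
`volUp n = {n ≤ |C_{H⁺}(e₀)|}`, `volDn n = {n ≤ |C_{H⁻}(0)|}`, `H⁺ = {x₀ ≥ 1}`, `H⁻ = {x₀ ≤ 0}`,
`e₀ = Pi.single 0 1`, and `footLe k = {|C_{H⁻}(0) ∩ {x₀ = 0}| ≤ k}`. Proof: independence of the halves,
then finite energy (`bondPercolation_real_finiteEnergy`, conditionally on the two half-configurations
the `≤ k` vertical edges above the foot are independent Bernoulli) and sealing
(`MirrorSealing.not_reachable_of_sealed`). This is the `k`-truncation of the direct-sealing lower bound
`w(n)·E[(1−p)^{|F|}; volDn n] ≤ P(volUp n ∩ volDn n ∩ distinct)` for the open stub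
`stub_mirrorNonCoalescence` of line `mirror-akn-two-arm-import`. -/
theorem mirror_sealing_bound :
    ∀ (p : unitInterval) (n k : ℕ), (1 - (p : ℝ)) ^ k *
        ((bondPercolation (zdGraph 3) p).real
            {ω | (n : ℕ∞) ≤ (openClusterIn (withinGraph (zdGraph 3) {x : Site 3 | 1 ≤ x 0}) ω (Pi.single 0 1)).encard} *
          (bondPercolation (zdGraph 3) p).real
            ({ω | (n : ℕ∞) ≤ (openClusterIn (withinGraph (zdGraph 3) {x : Site 3 | x 0 ≤ 0}) ω 0).encard} ∩
              {ω | (openClusterIn (withinGraph (zdGraph 3) {x : Site 3 | x 0 ≤ 0}) ω 0 ∩ {x : Site 3 | x 0 = 0}).encard ≤ k})) ≤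
      (bondPercolation (zdGraph 3) p).real
        ({ω | (n : ℕ∞) ≤ (openClusterIn (withinGraph (zdGraph 3) {x : Site 3 | 1 ≤ x 0}) ω (Pi.single 0 1)).encard} ∩
            {ω | (n : ℕ∞) ≤ (openClusterIn (withinGraph (zdGraph 3) {x : Site 3 | x 0 ≤ 0}) ω 0).encard} ∩
          {ω | ¬ (openGraph ω).Reachable (0 : Site 3) (Pi.single 0 1)}) := by
  intro p n k
  classical
  -- notation-free abbreviations
  set Kup : SimpleGraph (Site 3) := withinGraph (zdGraph 3) {x : Site 3 | 1 ≤ x 0} with hKup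
  set Kdn : SimpleGraph (Site 3) := withinGraph (zdGraph 3) {x : Site 3 | x 0 ≤ 0} with hKdn
  set L0 : Set (Site 3) := {x : Site 3 | x 0 = 0} with hL0
  set Up : Set (BondConfig (Site 3)) := {ω | (n : ℕ∞) ≤ (openClusterIn Kup ω (Pi.single 0 1)).encard} with hUp
  set Dn : Set (BondConfig (Site 3)) := {ω | (n : ℕ∞) ≤ (openClusterIn Kdn ω 0).encard} with hDn
  set Ft : Set (BondConfig (Site 3)) := {ω | (openClusterIn Kdn ω 0 ∩ L0).encard ≤ k} with hFt
  set Dis : Set (BondConfig (Site 3)) := {ω | ¬ (openGraph ω).Reachable (0 : Site 3) (Pi.single 0 1)} with hDis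
  -- the foot statistic and the edges to close
  set foot : BondConfig (Site 3) → Set (Site 3) := fun ω => openClusterIn Kdn ω 0 ∩ L0 with hfoot
  set Ψ : BondConfig (Site 3) → Finset (Site 3) := fun ω =>
    if h : (foot ω).Finite then h.toFinset else ∅ with hΨ
  set φ : Finset (Site 3) → Finset (Sym2 (Site 3)) := fun B => B.image fun v => s(v, v + Pi.single 0 1) with hφ
  set A : Set (BondConfig (Site 3)) := Up ∩ (Dn ∩ Ft) with hA
  set S : Set (Sym2 (Site 3)) := Kup.edgeSet ∪ Kdn.edgeSet with hS
  -- on `Ft` the foot is finite and `Ψ` is the foot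
  have hfin : ∀ ω ∈ Ft, (foot ω).Finite := fun ω hω => Set.finite_of_encard_le_coe hω
  have hΨeq : ∀ ω ∈ Ft, (↑(Ψ ω) : Set (Site 3)) = foot ω := by
    intro ω hω
    simp only [hΨ, dif_pos (hfin ω hω), Set.Finite.coe_toFinset]
  have hΨcard : ∀ ω ∈ Ft, (Ψ ω).card ≤ k := by
    intro ω hω
    have h1 := (hfin ω hω).encard_eq_coe_toFinset_card
    have h2 : (foot ω).encard ≤ k := hω
    rw [h1] at h2
    simp only [hΨ, dif_pos (hfin ω hω)]
    exact_mod_cast h2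
  -- `A ∩ {Ψ = B} = A ∩ {foot = B}`
  have hslice : ∀ B : Finset (Site 3), A ∩ Ψ ⁻¹' {B} = A ∩ {ω | foot ω = ↑B} := by
    intro B
    ext ω
    simp only [Set.mem_inter_iff, Set.mem_preimage, Set.mem_singleton_iff, Set.mem_setOf_eq]
    constructor
    · rintro ⟨hωA, rfl⟩
      exact ⟨hωA, (hΨeq ω hωA.2.2).symm⟩
    · rintro ⟨hωA, hB⟩
      refine ⟨hωA, ?_⟩
      apply Finset.coe_injective
      rw [hΨeq ω hωA.2.2, hB]
  -- hypotheses of the finite-energy lemma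
  have hdet : ∀ B, DeterminedBy (A ∩ Ψ ⁻¹' {B}) S := by
    intro B
    rw [hslice]
    have e : A ∩ {ω | foot ω = ↑B} = Up ∩ {ω | (n : ℕ∞) ≤ (openClusterIn Kdn ω 0).encard ∧
        (openClusterIn Kdn ω 0 ∩ L0).encard ≤ k ∧ openClusterIn Kdn ω 0 ∩ L0 = ↑B} := by
      ext ω; simp only [hA, hDn, hFt, hfoot, Set.mem_inter_iff, Set.mem_setOf_eq, and_assoc]
    rw [e]
    refine ((determinedBy_volUp n).mono Set.subset_union_left).inter ?_
    exact (determinedBy_setOf_openClusterIn (fun C => (n : ℕ∞) ≤ C.encard ∧ (C ∩ L0).encard ≤ k ∧ C ∩ L0 = ↑B)).mono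
      Set.subset_union_right
  have hmeas : ∀ B, MeasurableSet (A ∩ Ψ ⁻¹' {B}) := by
    intro B
    rw [hslice]
    exact ((measurableSet_volUp n).inter ((measurableSet_volDn n).inter (measurableSet_footLe k))).inter
      (measurableSet_foot_eq _)
  have hdisj : ∀ ω ∈ A, Disjoint (↑(φ (Ψ ω)) : Set (Sym2 (Site 3))) S := by
    intro ω hω
    rw [Set.disjoint_left]
    intro e he heS
    rw [Finset.mem_coe] at he
    simp only [hφ, Finset.mem_image] at he
    obtain ⟨v, hv, rfl⟩ := he
    have hv' : v ∈ foot ω := by rw [← hΨeq ω hω.2.2]; exact hv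
    have hv0 : v 0 = 0 := hv'.2
    rcases heS with h | h
    · exact edgeUp_notMem_up hv0 h
    · exact edgeUp_notMem_dn hv0 h
  have hcard : ∀ ω ∈ A, (φ (Ψ ω)).card ≤ k := fun ω hω =>
    Finset.card_image_le.trans (hΨcard ω hω.2.2)
  -- finite energy
  have hFE := bondPercolation_real_finiteEnergy (zdGraph 3) p (A := A) S Ψ φ k hdet hmeas hdisj hcard
  -- independence of the halves
  have hind : (bondPercolation (zdGraph 3) p).real A =
      (bondPercolation (zdGraph 3) p).real Up * (bondPercolation (zdGraph 3) p).real (Dn ∩ Ft) :=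
    real_volUp_inter_volDn_footLe p n k
  -- sealing: the closed event lies in `volUp ∩ volDn ∩ distinct` (a.s.)
  have hincl : (bondPercolation (zdGraph 3) p).real (A ∩ {ω | ∀ e ∈ φ (Ψ ω), e ∉ ω}) ≤
      (bondPercolation (zdGraph 3) p).real (Up ∩ Dn ∩ Dis) := by
    refine DCT16.real_mono_of_forall_subset_edgeSet (zdGraph 3) p fun ω hω hωA => ?_
    obtain ⟨⟨hU, hD, hF⟩, hclosed⟩ := hωA
    refine ⟨⟨hU, hD⟩, ?_⟩
    refine not_reachable_of_sealed hω fun v hv hv0 => hclosed _ ?_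
    simp only [hφ, Finset.mem_image]
    refine ⟨v, ?_, rfl⟩
    rw [← Finset.mem_coe, hΨeq ω hF]
    exact ⟨hv, hv0⟩
  -- assemble
  calc (1 - (p : ℝ)) ^ k * ((bondPercolation (zdGraph 3) p).real Up * (bondPercolation (zdGraph 3) p).real (Dn ∩ Ft))
      = (1 - (p : ℝ)) ^ k * (bondPercolation (zdGraph 3) p).real A := by rw [hind]
    _ ≤ (bondPercolation (zdGraph 3) p).real (A ∩ {ω | ∀ e ∈ φ (Ψ ω), e ∉ ω}) := hFE
    _ ≤ (bondPercolation (zdGraph 3) p).real (Up ∩ Dn ∩ Dis) := hincl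

end Summit.CriticalPhenomena.PercolationContinuityZ3.Theorems

end
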